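import Summits.MatrixMultiplication.MatrixMultiplication.Theorems.SaturationLadderTowerThree
import Summits.MatrixMultiplication.MatrixMultiplication.Theorems.FarEdgeDescentSchonhagePairBase
import HarnessLib

/-!
# Route `SaturationLadder` on Strassen's spectrum, XVIII: THE CEILING OF EVERY OUTPUT-PERFECT SQUARING TOWER — a hypothesis-free window, and Schönhage's pairs

decomp-mm lens 1 «grading / quantitative ladder», gen 50, kernel K50-W (part 2 of 3; part 1 = `SaturationLadderTowerThree`).
Def-free, sorry-free support module beneath the deciding crux `SubexpSaturation` (stmt-MatrixMultiplication-25909) of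
`route-MatrixMultiplication-SaturationLadder`; cut of record UNCHANGED (`closes (h₁ : SubexpSaturation) (h₂ : SubexpToPoly)
(h₃ : PolyToFinite) (h₄ : TailDescentTwo) (h₅ : SquareFromTwo)`).  `θ = specMMPoint K φ`, `εᵢ = 1 − θᵢ`.

THE METHOD CEILING AS A THEOREM (critic ask g50 FIRST; memo NODE-SaturationLadder-g50 §2).  Part 1 exported the seven
sequences of the generic three-family isolated squaring tower.  §1 is their PURE ARITHMETIC, with NO side hypothesis
(XVI `ladder_arith` needed `r₀ ≤ 3Q₀`, false for asymmetric towers where `Q_j/r_j → 0`): the plateau abscissae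
`t_j = B_j/A_j` INCREASE STRICTLY (`Q' = Q² + 2XY > Q²`), each step gains at most `log r_j/(r_j A_j)`
(`Q' ≤ r_j²`), and since `r' = r²`, `A' = 2rA` the gains decay like `1/r_j²`: the potential
`t_j + λ₀·log r_j/(r_j A_j)`, `λ₀ = r₀²/(r₀² − 1)`, is NON-INCREASING.  Hence the two-sided WINDOW
`t_{j₀} ≤ t_j ≤ t_{j₀} + λ₀ log r_{j₀}/(r_{j₀}A_{j₀})` (`j ≥ j₀`) and the CEILING `t_j < t₀ + λ₀ log r₀/(r₀A₀)` for
every `j` — for EVERY output-perfect isolated base, symmetric or not; the third side `ρ = C_j/A_j = C₀/A₀` is constant.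
§2 reads it out (XVII `thinTowerChain₃` + `thinExact_iff_roof`): every stage is an exact thin point
`ω_K(1, t_j, ρ) = 1 + ρ` over every field, with the window and the ceiling (`thinTowerCeiling₃`).  §3 instantiates on
SCHÖNHAGE'S PAIRS `⟨1,(e−1)(l−1),1⟩ ⊕ ⟨e,1,l⟩` (`e,l ≥ 2`; isolated base = route `FarEdgeDescent` XXXV-C
`base_isolated_pair`, `r₀ = el + 1`): `t₀ = log((e−1)(l−1))/(el·log e)` (the census point
`thinPoint_schoenhagePair`), `ρ = log l/log e`, `A₀ = el·log e`, and ALL tower stages are exact points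
`ω_K(1, t_j, log l/log e) = 1 + log l/log e`, `t₀ < t₁ < … < t₀ + λ₀·log(el+1)/((el+1)·el·log e)` (`schoenhagePairTower`);
part 3 (`SaturationLadderTowerSchoenhage`) draws the numbers (`e = l`: every stage below Coppersmith's `α`; `(2,5)`: `< 1/4`).
Tags: `SubexpSaturation` (h₁) NEC-side ladder · WEAKER · ATTACKED · method ceiling (BC9-type, a theorem).  No defs.
[cite: Schonhage1981, §5] [cite: Pan1984, Props. 16.2–16.5, Thm. 17.1] [cite: Coppersmith1982, Theorem (BCS 1997 Thm. (15.51))]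
[cite: CoppersmithWinograd1990, §6] [cite: Stothers2010, §1, Thm. 8] [cite: Strassen1988, Thm. 3.8]
-/

set_option linter.dupNamespace false

noncomputable section

open scoped BigOperators Polynomial
open Polynomial

namespace Summit.MatrixMultiplication.MatrixMultiplication.Theorems.SaturationLadderTowerCeiling

open Literature.Computability.AlgebraicComplexity
open Summit.MatrixMultiplication.MatrixMultiplication.Theorems.FarEdgeDescentTowerChain
open Summit.MatrixMultiplication.MatrixMultiplication.Theorems.FarEdgeDescentSchonhagePairBase
open Summit.MatrixMultiplication.MatrixMultiplication.Theorems.SaturationLadderPerfectPacking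
open Summit.MatrixMultiplication.MatrixMultiplication.Theorems.SaturationLadderThinRoof
open Summit.MatrixMultiplication.MatrixMultiplication.Theorems.SaturationLadderTowerThree

/-! ## §1 Arithmetic of the generic recursion: strict increase, the hypothesis-free potential, windows, ceiling -/

/-- **THE LADDER OF THE GENERIC TOWER** (pure arithmetic of the recursion of `thinTowerChain₃`, no side hypothesis).
With `X₀, Y₀ ≥ 1`, `A₀ > 0`: `X_j, Y_j ≥ 1`, `r_j ≥ 3`, `A_j > 0`, `C_j/A_j = C₀/A₀`; the plateau abscissae `t_j = B_j/A_j`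
INCREASE STRICTLY, each step gains at most `log r_j/(r_j A_j)`, the potential `t_j + λ₀·log r_j/(r_jA_j)`
(`λ₀ = r₀²/(r₀² − 1)`) is NON-INCREASING; hence the windows `t_{j₀} ≤ t_j ≤ t_{j₀} + λ₀ log r_{j₀}/(r_{j₀}A_{j₀})` and the
ceiling `t_j < t₀ + λ₀ log r₀/(r₀A₀)`. [folklore] [cite: Pan1984, Props. 16.2–16.5] -/
theorem ladder_arith₃ (r Q X Y : ℕ → ℕ) (A B C : ℕ → ℝ)
    (hsum : ∀ j, Q j + X j + Y j = r j) (hQ1 : ∀ j, 1 ≤ Q j) (hX0 : 1 ≤ X 0) (hY0 : 1 ≤ Y 0)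
    (hA0 : 0 < A 0)
    (hX : ∀ j, X (j + 1) = (Q j + X j) ^ 2 - Q j ^ 2) (hY : ∀ j, Y (j + 1) = (Q j + Y j) ^ 2 - Q j ^ 2)
    (hr : ∀ j, r (j + 1) = r j ^ 2) (hQ : ∀ j, Q (j + 1) = Q j ^ 2 + 2 * X j * Y j)
    (hA : ∀ j, A (j + 1) = 2 * (r j : ℝ) * A j)
    (hB : ∀ j, B (j + 1) = 2 * (r j : ℝ) * B j - 2 * Real.log (Q j) + Real.log (Q (j + 1)))
    (hC : ∀ j, C (j + 1) = 2 * (r j : ℝ) * C j) :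
    (∀ j, 1 ≤ X j) ∧ (∀ j, 1 ≤ Y j) ∧ (∀ j, 3 ≤ r j) ∧ (∀ j, r 0 ≤ r j) ∧ (∀ j, 0 < A j) ∧
    (∀ j, C j / A j = C 0 / A 0) ∧
    (∀ j, B j / A j < B (j + 1) / A (j + 1)) ∧
    (∀ j, B (j + 1) / A (j + 1) ≤ B j / A j + Real.log (r j) / ((r j : ℝ) * A j)) ∧
    (∀ j, B (j + 1) / A (j + 1) +
        (r 0 : ℝ) ^ 2 / ((r 0 : ℝ) ^ 2 - 1) * (Real.log (r (j + 1)) / ((r (j + 1) : ℝ) * A (j + 1))) ≤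
      B j / A j + (r 0 : ℝ) ^ 2 / ((r 0 : ℝ) ^ 2 - 1) * (Real.log (r j) / ((r j : ℝ) * A j))) ∧
    (∀ j₀ j, j₀ ≤ j → B j₀ / A j₀ ≤ B j / A j ∧
      B j / A j ≤ B j₀ / A j₀ + (r 0 : ℝ) ^ 2 / ((r 0 : ℝ) ^ 2 - 1) * (Real.log (r j₀) / ((r j₀ : ℝ) * A j₀))) ∧
    (∀ j, B j / A j <
      B 0 / A 0 + (r 0 : ℝ) ^ 2 / ((r 0 : ℝ) ^ 2 - 1) * (Real.log (r 0) / ((r 0 : ℝ) * A 0))) := by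
  set c : ℝ := (r 0 : ℝ) ^ 2 / ((r 0 : ℝ) ^ 2 - 1) with hc
  have eX : ∀ j, X (j + 1) = 2 * Q j * X j + X j ^ 2 := fun j => by
    rw [hX]
    exact Nat.sub_eq_of_eq_add (by ring)
  have eY : ∀ j, Y (j + 1) = 2 * Q j * Y j + Y j ^ 2 := fun j => by
    rw [hY]
    exact Nat.sub_eq_of_eq_add (by ring)
  have hX1 : ∀ j, 1 ≤ X j := fun j => by
    induction j with
    | zero => exact hX0
    | succ j ih =>
      rw [eX]
      exact ih.trans ((Nat.le_self_pow two_ne_zero _).trans (Nat.le_add_left _ _))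
  have hY1 : ∀ j, 1 ≤ Y j := fun j => by
    induction j with
    | zero => exact hY0
    | succ j ih =>
      rw [eY]
      exact ih.trans ((Nat.le_self_pow two_ne_zero _).trans (Nat.le_add_left _ _))
  have hr3 : ∀ j, 3 ≤ r j := fun j => by
    have := hsum j; have := hQ1 j; have := hX1 j; have := hY1 j; omega
  have hr0 : ∀ j, r 0 ≤ r j := fun j => by
    induction j with
    | zero => exact le_rfl
    | succ j ih => rw [hr]; exact ih.trans (Nat.le_self_pow two_ne_zero _)
  have hrpos : ∀ j, (0 : ℝ) < r j := fun j => by exact_mod_cast (show 0 < r j from by have := hr3 j; omega)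
  have hr1 : ∀ j, (1 : ℝ) ≤ r j := fun j => by exact_mod_cast (show 1 ≤ r j from by have := hr3 j; omega)
  have hApos : ∀ j, 0 < A j := fun j => by
    induction j with
    | zero => exact hA0
    | succ j ih => rw [hA]; exact mul_pos (mul_pos two_pos (hrpos j)) ih
  have hCA : ∀ j, C j / A j = C 0 / A 0 := fun j => by
    induction j with
    | zero => rfl
    | succ j ih =>
      rw [hC, hA, mul_div_mul_left _ _ (mul_pos two_pos (hrpos j)).ne']
      exact ih
  have hQpos : ∀ j, (0 : ℝ) < Q j := fun j => Nat.cast_pos.mpr (hQ1 j)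
  -- the increments `δ_j = log Q_{j+1} − 2 log Q_j ∈ (0, 2 log r_j]`
  have hδpos : ∀ j, 0 < Real.log (Q (j + 1)) - 2 * Real.log (Q j) := fun j => by
    have h1 : ((Q j : ℕ) : ℝ) ^ 2 < Q (j + 1) := by
      have : Q j ^ 2 < Q (j + 1) := by rw [hQ]; nlinarith [hX1 j, hY1 j]
      exact_mod_cast this
    have h2 := Real.log_lt_log (by have := hQpos j; positivity) h1
    rw [Real.log_pow] at h2
    push_cast at h2
    linarith
  have hδle : ∀ j, Real.log (Q (j + 1)) - 2 * Real.log (Q j) ≤ 2 * Real.log (r j) := fun j => by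
    have h1 : ((Q (j + 1) : ℕ) : ℝ) ≤ ((r j : ℕ) : ℝ) ^ 2 := by
      have h' : (Q j + X j + Y j) ^ 2 =
          Q j ^ 2 + 2 * X j * Y j + (X j ^ 2 + Y j ^ 2 + 2 * Q j * X j + 2 * Q j * Y j) := by ring
      have : Q (j + 1) ≤ r j ^ 2 := by rw [hQ, ← hsum j, h']; exact Nat.le_add_right _ _
      exact_mod_cast this
    have h2 := Real.log_le_log (hQpos (j + 1)) h1
    rw [Real.log_pow] at h2
    push_cast at h2
    have h3 : 0 ≤ Real.log (Q j) := Real.log_nonneg (by exact_mod_cast hQ1 j)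
    linarith
  -- one step: `t' = t + δ/(2rA)`
  have ht' : ∀ j, B (j + 1) / A (j + 1) =
      B j / A j + (Real.log (Q (j + 1)) - 2 * Real.log (Q j)) / (2 * (r j : ℝ) * A j) := fun j => by
    have := (hApos j).ne'
    have := (hrpos j).ne'
    rw [hA, hB]
    field_simp
    ring
  have hstep : ∀ j, B j / A j < B (j + 1) / A (j + 1) := fun j => by
    rw [ht']
    have : 0 < (Real.log (Q (j + 1)) - 2 * Real.log (Q j)) / (2 * (r j : ℝ) * A j) :=
      div_pos (hδpos j) (mul_pos (mul_pos two_pos (hrpos j)) (hApos j))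
    linarith
  have hstep_le : ∀ j, B (j + 1) / A (j + 1) ≤ B j / A j + Real.log (r j) / ((r j : ℝ) * A j) :=
    fun j => by
    rw [ht']
    have h1 : (Real.log (Q (j + 1)) - 2 * Real.log (Q j)) / (2 * (r j : ℝ) * A j) ≤
        (2 * Real.log (r j)) / (2 * (r j : ℝ) * A j) :=
      div_le_div_of_nonneg_right (hδle j) (mul_pos (mul_pos two_pos (hrpos j)) (hApos j)).le
    have h2 : (2 * Real.log (r j)) / (2 * (r j : ℝ) * A j) = Real.log (r j) / ((r j : ℝ) * A j) := by
      rw [mul_assoc, mul_div_mul_left _ _ (two_ne_zero)]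
    linarith
  -- the constant `λ₀ = c = r₀²/(r₀² − 1) ≥ 1` and the key inequality `1 + c/r_j² ≤ c`
  have hr0sq : (1 : ℝ) < (r 0 : ℝ) ^ 2 := by
    have h3 : (3 : ℝ) ≤ r 0 := by exact_mod_cast hr3 0
    nlinarith
  have hden : 0 < (r 0 : ℝ) ^ 2 - 1 := by linarith
  have hc_mul : c * ((r 0 : ℝ) ^ 2 - 1) = (r 0 : ℝ) ^ 2 := div_mul_cancel₀ _ hden.ne'
  have hc1 : 1 ≤ c := by rw [hc, le_div_iff₀ hden]; linarith
  have hc0 : 0 ≤ c := zero_le_one.trans hc1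
  have hw0 : ∀ j, 0 ≤ Real.log (r j) / ((r j : ℝ) * A j) := fun j =>
    div_nonneg (Real.log_nonneg (hr1 j)) (mul_pos (hrpos j) (hApos j)).le
  have hw' : ∀ j, Real.log (r (j + 1)) / ((r (j + 1) : ℝ) * A (j + 1)) =
      Real.log (r j) / ((r j : ℝ) * A j) / (r j : ℝ) ^ 2 := fun j => by
    have := (hApos j).ne'
    have := (hrpos j).ne'
    rw [hA, hr]
    push_cast
    rw [Real.log_pow]
    push_cast
    field_simp
  have hkey : ∀ j, 1 + c / (r j : ℝ) ^ 2 ≤ c := fun j => by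
    have hρ : ((r 0 : ℕ) : ℝ) ^ 2 ≤ ((r j : ℕ) : ℝ) ^ 2 := by
      exact_mod_cast Nat.pow_le_pow_left (hr0 j) 2
    have hρpos : (0 : ℝ) < (r j : ℝ) ^ 2 := by have := hrpos j; positivity
    rw [add_div' _ _ _ hρpos.ne', div_le_iff₀ hρpos]
    nlinarith [mul_le_mul_of_nonneg_left hρ (sub_nonneg.mpr hc1), hc_mul]
  -- the potential is non-increasing
  have hpot : ∀ j, B (j + 1) / A (j + 1) + c * (Real.log (r (j + 1)) / ((r (j + 1) : ℝ) * A (j + 1))) ≤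
      B j / A j + c * (Real.log (r j) / ((r j : ℝ) * A j)) := fun j => by
    rw [hw']
    have h1 := hstep_le j
    have h2 : Real.log (r j) / ((r j : ℝ) * A j) +
        c * (Real.log (r j) / ((r j : ℝ) * A j) / (r j : ℝ) ^ 2) =
        Real.log (r j) / ((r j : ℝ) * A j) * (1 + c / (r j : ℝ) ^ 2) := by ring
    have h3 : Real.log (r j) / ((r j : ℝ) * A j) * (1 + c / (r j : ℝ) ^ 2) ≤
        Real.log (r j) / ((r j : ℝ) * A j) * c := mul_le_mul_of_nonneg_left (hkey j) (hw0 j)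
    linarith [h1, h2, h3]
  have hmono : ∀ j₀ j, j₀ ≤ j → B j₀ / A j₀ ≤ B j / A j := fun j₀ j hj => by
    induction j, hj using Nat.le_induction with
    | base => exact le_rfl
    | succ j _ ih => exact ih.trans (hstep j).le
  have hΦ : ∀ j₀ j, j₀ ≤ j → B j / A j + c * (Real.log (r j) / ((r j : ℝ) * A j)) ≤
      B j₀ / A j₀ + c * (Real.log (r j₀) / ((r j₀ : ℝ) * A j₀)) := fun j₀ j hj => by
    induction j, hj using Nat.le_induction with
    | base => exact le_rfl
    | succ j _ ih => exact (hpot j).trans ih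
  have hwin : ∀ j₀ j, j₀ ≤ j →
      B j / A j ≤ B j₀ / A j₀ + c * (Real.log (r j₀) / ((r j₀ : ℝ) * A j₀)) := fun j₀ j hj => by
    have := hΦ j₀ j hj
    have := mul_nonneg hc0 (hw0 j)
    linarith
  exact ⟨hX1, hY1, hr3, hr0, hApos, hCA, hstep, hstep_le, hpot,
    fun j₀ j hj => ⟨hmono j₀ j hj, hwin j₀ j hj⟩,
    fun j => (hstep j).trans_le (hwin 0 (j + 1) (Nat.zero_le _))⟩

/-! ## §2 The read-out: every stage an exact thin point at the constant third side, with window and ceiling -/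

variable (K : Type) [Field K]

/-- **THE CEILING OF A GENERIC OUTPUT-PERFECT ISOLATED SQUARING TOWER.**  In the setting of XVII `thinTowerChain₃`
(anchored family `⊕ᵢ⟨kᵢ,mᵢ,nᵢ⟩`, isolated anchor, output-perfect, leg sums `X₀, Y₀ ≥ 1`, some `kᵢ ≥ 2` so that
`A₀ = ∑kn log k > 0`): with `t_j = B_j/A_j`, `ρ = (∑kn log n)/(∑kn log k)`, `λ₀ = r₀²/(r₀² − 1)`, EVERY stage is an
exact thin point `ω_K(1, t_j, ρ) = 1 + ρ` over `K`, `t₀ < t₁ < …`, `t_j ≤ t_{j₀} + λ₀ log r_{j₀}/(r_{j₀}A_{j₀})`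
(`j ≥ j₀`), and `t_j < t₀ + λ₀ log r₀/(r₀A₀)` for all `j` — the squaring method on this base never produces a thin point
beyond that abscissa at third side `ρ`. [cite: Pan1984, Props. 16.2–16.5, Thm. 17.1] [cite: Schonhage1981, §5]
[cite: Coppersmith1982, Theorem (BCS 1997 Thm. (15.51))] [cite: Strassen1988, Thm. 3.8] -/
theorem thinTowerCeiling₃ {P : ℕ} (k m n : Fin P → ℕ) (i₀ : Fin P) (hk₀ : k i₀ = 1) (hn₀ : n i₀ = 1)
    (hk : ∀ i, 1 ≤ k i) (hm : ∀ i, 1 ≤ m i) (hn : ∀ i, 1 ≤ n i) {X₀ Y₀ r₀ h₀ : ℕ}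
    (hX₀ : ∑ i, k i * m i = m i₀ + X₀) (hY₀ : ∑ i, m i * n i = m i₀ + Y₀)
    (hsum₀ : m i₀ + X₀ + Y₀ = r₀) (hW₀ : ∑ i, k i * n i = r₀)
    (hinv₀ : ∃ (u : Fin r₀ → _ → K[X]) (v : Fin r₀ → _ → K[X]) (w : Fin r₀ → _ → K[X])
      (d : Fin r₀ → K[X]),
      IsApproxDecomposition h₀ (matMulDirectSum K k m n) u v w ∧ (∀ s, d s ≠ 0) ∧
        ∀ b c, ¬ (b.1 = i₀ ∧ c.1 = i₀) → ∑ s, d s * v s b * w s c = 0)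
    (hX1 : 1 ≤ X₀) (hY1 : 1 ≤ Y₀) (hA0 : 0 < ∑ i, (k i : ℝ) * n i * Real.log (k i)) :
    ∃ (r : ℕ → ℕ) (A B : ℕ → ℝ),
      r 0 = r₀ ∧ A 0 = ∑ i, (k i : ℝ) * n i * Real.log (k i) ∧
      B 0 = ∑ i, (k i : ℝ) * n i * Real.log (m i) ∧
      (∀ j, r (j + 1) = r j ^ 2) ∧ (∀ j, A (j + 1) = 2 * (r j : ℝ) * A j) ∧ (∀ j, 0 < A j) ∧
      (∀ j, B j / A j < B (j + 1) / A (j + 1)) ∧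
      (∀ j, omegaRect K 1 (B j / A j)
          ((∑ i, (k i : ℝ) * n i * Real.log (n i)) / ∑ i, (k i : ℝ) * n i * Real.log (k i)) =
        1 + (∑ i, (k i : ℝ) * n i * Real.log (n i)) / ∑ i, (k i : ℝ) * n i * Real.log (k i)) ∧
      (∀ j₀ j, j₀ ≤ j → B j / A j ≤
        B j₀ / A j₀ + (r₀ : ℝ) ^ 2 / ((r₀ : ℝ) ^ 2 - 1) * (Real.log (r j₀) / ((r j₀ : ℝ) * A j₀))) ∧
      (∀ j, B j / A j <
        B 0 / A 0 + (r₀ : ℝ) ^ 2 / ((r₀ : ℝ) ^ 2 - 1) * (Real.log r₀ / ((r₀ : ℝ) * A 0))) := by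
  obtain ⟨r, Q, X, Y, A, B, C, h0r, h0Q, h0X, h0Y, h0A, h0B, h0C, hsum, hQ1, hX, hY, hr, hQ, hA, hB, hC,
    hB0, hroof⟩ := thinTowerChain₃ K k m n i₀ hk₀ hn₀ hk hm hn hX₀ hY₀ hsum₀ hW₀ hinv₀
  obtain ⟨-, -, -, -, hApos, hCA, hstep, -, -, hwin, hceil⟩ :=
    ladder_arith₃ r Q X Y A B C hsum hQ1 (h0X.symm ▸ hX1) (h0Y.symm ▸ hY1) (h0A.symm ▸ hA0) hX hY hr
      hQ hA hB hC
  have hC0 : 0 ≤ C 0 := by rw [h0C]; exact shapeSum_nonneg n hn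
  have hρ : 0 ≤ C 0 / A 0 := div_nonneg hC0 (hApos 0).le
  refine ⟨r, A, B, h0r, h0A, h0B, hr, hA, hApos, hstep, fun j => ?_, fun j₀ j hj => ?_, fun j => ?_⟩
  · rw [← h0C, ← h0A, thinExact_iff_roof (K := K) (div_nonneg (hB0 j) (hApos j).le) hρ]
    intro F hF
    have h := hroof j F hF
    have hAj := hApos j
    rw [← hCA j]
    calc B j / A j * specMMPoint K F 1 = B j * specMMPoint K F 1 / A j := by ring
      _ ≤ (A j * (1 - specMMPoint K F 0) + C j * (1 - specMMPoint K F 2)) / A j :=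
          div_le_div_of_nonneg_right h hAj.le
      _ = (1 - specMMPoint K F 0) + C j / A j * (1 - specMMPoint K F 2) := by
          field_simp
  · rw [← h0r]
    exact (hwin j₀ j hj).2
  · rw [← h0r]
    exact hceil j

/-! ## §3 Schönhage's pairs: all tower stages are exact thin points, with their ceiling -/

/-- **THE SQUARING TOWER OF A SCHÖNHAGE PAIR `⟨1,(e−1)(l−1),1⟩ ⊕ ⟨e,1,l⟩` (`e, l ≥ 2`), every field.**  From route
`FarEdgeDescent`'s isolated base (XXXV-C `base_isolated_pair`, `r₀ = el + 1`, output-perfect: `1 + el` output entries):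
the tower's plateau abscissae `t₀ = log((e−1)(l−1))/(el·log e) < t₁ < t₂ < …` are ALL exact thin points at the constant
third side `ρ = log l/log e`, `ω_K(1, t_j, log l/log e) = 1 + log l/log e` (stage `0` is the census point
`thinPoint_schoenhagePair`), confined below the CEILING `t₀ + λ₀·log(el+1)/((el+1)·el·log e)`, `λ₀ = (el+1)²/((el+1)²−1)`;
later windows `t_j ≤ t_{j₀} + λ₀ log r_{j₀}/(r_{j₀}A_{j₀})` with `r' = r²`, `A' = 2rA`, `A₀ = el·log e` are exported too.
[cite: Schonhage1981, §5] [cite: Pan1984, Props. 16.2–16.5, Thm. 17.1] [cite: CoppersmithWinograd1990, §6]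
[cite: Coppersmith1982, Theorem (BCS 1997 Thm. (15.51))] -/
theorem schoenhagePairTower (e l : ℕ) (he : 2 ≤ e) (hl : 2 ≤ l) :
    ∃ (t : ℕ → ℝ) (r : ℕ → ℕ) (A : ℕ → ℝ),
      t 0 = Real.log (((e - 1) * (l - 1) : ℕ) : ℝ) / ((e : ℝ) * l * Real.log e) ∧
      r 0 = e * l + 1 ∧ A 0 = (e : ℝ) * l * Real.log e ∧
      (∀ j, r (j + 1) = r j ^ 2) ∧ (∀ j, A (j + 1) = 2 * (r j : ℝ) * A j) ∧
      (∀ j, t j < t (j + 1)) ∧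
      (∀ j, omegaRect K 1 (t j) (Real.log l / Real.log e) = 1 + Real.log l / Real.log e) ∧
      (∀ j₀ j, j₀ ≤ j → t j ≤ t j₀ +
        ((e : ℝ) * l + 1) ^ 2 / (((e : ℝ) * l + 1) ^ 2 - 1) * (Real.log (r j₀) / ((r j₀ : ℝ) * A j₀))) ∧
      (∀ j, t j < Real.log (((e - 1) * (l - 1) : ℕ) : ℝ) / ((e : ℝ) * l * Real.log e) +
        ((e : ℝ) * l + 1) ^ 2 / (((e : ℝ) * l + 1) ^ 2 - 1) *
          (Real.log ((e : ℝ) * l + 1) / (((e : ℝ) * l + 1) * ((e : ℝ) * l * Real.log e)))) := by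
  have he' : 1 ≤ e := by omega
  have hl' : 1 ≤ l := by omega
  have hq1 : 1 ≤ (e - 1) * (l - 1) := Nat.mul_pos (by omega) (by omega)
  have he1 : (1 : ℝ) < e := by exact_mod_cast he
  have hl1 : (1 : ℝ) < l := by exact_mod_cast hl
  have hloge : 0 < Real.log e := Real.log_pos he1
  have hel : (0 : ℝ) < (e : ℝ) * l := by positivity
  obtain ⟨H, hinv⟩ := base_isolated_pair K he' hl'
  have hA0sum : (∑ i, (((Fin.cons 1 (fun _ : Fin 1 => e) : Fin (1 + 1) → ℕ) i : ℕ) : ℝ) *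
      ((Fin.cons 1 (fun _ : Fin 1 => l) : Fin (1 + 1) → ℕ) i) *
      Real.log (((Fin.cons 1 (fun _ : Fin 1 => e) : Fin (1 + 1) → ℕ) i) : ℝ)) =
      (e : ℝ) * l * Real.log e := by
    simp [Fin.sum_univ_succ]
  have hB0sum : (∑ i, (((Fin.cons 1 (fun _ : Fin 1 => e) : Fin (1 + 1) → ℕ) i : ℕ) : ℝ) *
      ((Fin.cons 1 (fun _ : Fin 1 => l) : Fin (1 + 1) → ℕ) i) *
      Real.log (((Fin.cons ((e - 1) * (l - 1)) (fun _ : Fin 1 => 1) : Fin (1 + 1) → ℕ) i) : ℝ)) =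
      Real.log (((e - 1) * (l - 1) : ℕ) : ℝ) := by
    simp [Fin.sum_univ_succ]
  have hC0sum : (∑ i, (((Fin.cons 1 (fun _ : Fin 1 => e) : Fin (1 + 1) → ℕ) i : ℕ) : ℝ) *
      ((Fin.cons 1 (fun _ : Fin 1 => l) : Fin (1 + 1) → ℕ) i) *
      Real.log (((Fin.cons 1 (fun _ : Fin 1 => l) : Fin (1 + 1) → ℕ) i) : ℝ)) =
      (e : ℝ) * l * Real.log l := by
    simp [Fin.sum_univ_succ]
  have hA0 : 0 < (∑ i, (((Fin.cons 1 (fun _ : Fin 1 => e) : Fin (1 + 1) → ℕ) i : ℕ) : ℝ) *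
      ((Fin.cons 1 (fun _ : Fin 1 => l) : Fin (1 + 1) → ℕ) i) *
      Real.log (((Fin.cons 1 (fun _ : Fin 1 => e) : Fin (1 + 1) → ℕ) i) : ℝ)) := by
    rw [hA0sum]
    positivity
  obtain ⟨r, A, B, h0r, h0A, h0B, hr, hA, hApos, hstep, hpt, hwin, hceil⟩ :=
    thinTowerCeiling₃ K (Fin.cons 1 (fun _ : Fin 1 => e)) (Fin.cons ((e - 1) * (l - 1)) (fun _ : Fin 1 => 1))
      (Fin.cons 1 (fun _ : Fin 1 => l)) 0 (by simp) (by simp)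
      (cons_mid_one_le _ 1 (fun _ => he') le_rfl) (cons_mid_one_le _ _ (fun _ => le_rfl) hq1)
      (cons_mid_one_le _ 1 (fun _ => hl') le_rfl) (X₀ := e) (Y₀ := l) (r₀ := e * l + 1)
      (by simp [Fin.sum_univ_succ]) (by simp [Fin.sum_univ_succ])
      (by simp only [Fin.cons_zero]; zify [he', hl']; ring) (by simp [Fin.sum_univ_succ]; ring) hinv he' hl' hA0
  rw [hA0sum, hC0sum] at hpt
  rw [hA0sum] at h0A
  rw [hB0sum] at h0B
  have hρ : (e : ℝ) * l * Real.log l / ((e : ℝ) * l * Real.log e) = Real.log l / Real.log e :=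
    mul_div_mul_left _ _ hel.ne'
  rw [hρ] at hpt
  have hcast : ((e * l + 1 : ℕ) : ℝ) = (e : ℝ) * l + 1 := by push_cast; ring
  refine ⟨fun j => B j / A j, r, A, by show B 0 / A 0 = _; rw [h0B, h0A], h0r, h0A, hr, hA, hstep, hpt,
    fun j₀ j hj => ?_, fun j => ?_⟩
  · have h := hwin j₀ j hj
    rwa [hcast] at h
  · have h := hceil j
    rwa [hcast, h0A, h0B] at h

end Summit.MatrixMultiplication.MatrixMultiplication.Theorems.SaturationLadderTowerCeiling

end
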